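import Mathlib.Analysis.InnerProductSpace.PiL2
import Mathlib.Analysis.InnerProductSpace.Projection.Submodule
import Literature.NumberTheory.LFunctions.MoebiusAutomaticFourierDecay
import Literature.NumberTheory.LFunctions.MoebiusAutomaticCarryRelabel
import HarnessLib

/-!
# The regular representation of the transducer group, and Müllner's Thm. 4.4 as an interface (Müllner 2017, §4.3)

Everything in this file is PROVED, except that it DEFINES (does not assert) the statement
`MatrixMauduitRivat k` of Müllner's Mauduit–Rivat type theorem (Thm. 4.4 of C. Müllner,
*Automatic sequences fulfill the Sarnak conjecture*, Duke Math. J. 166 (2017) = arXiv:1602.03042)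
in the operator form in which the tree's proof of Prop. 3.2 consumes it.

* `regRep S` — the left regular representation `(R(g)F)(x) = F(g⁻¹x)` of a finite group `S` on
  `ℓ²(S) = EuclideanSpace ℂ S` (unitary: `norm_regRep`); `R(g) δ_h = δ_{gh}` (`regRep_single`)
  and the matrix coefficient `⟨δ_π, R(g) δ_1⟩ = [g = π]` (`inner_single_regRep_single`) — the
  indicators `[T̄(M,(n)_k) = π]` of Prop. 3.2 are matrix coefficients of `R` (Müllner's "it is
  sufficient to consider unitary irreducible representations", §3.1, via Peter–Weyl; here the
  regular representation is used directly);
* `MatrixMauduitRivat k` — **Thm. 4.4 as a property of the base `k`** (NOT asserted): for a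
  finite-dimensional complex inner-product space `W`, a group `G`, a sequence `f : ℕ → G` with
  the carry property (Def. 4.1, `HasCarryProperty k η C f`, `0 < η ≤ 1`) and an isometric
  representation `U : G →* End(W)` such that `n ↦ U(f(n))` has uniformly small Fourier transforms
  (Def. 4.2, `MauduitRivat.HasFourierProperty k γ c`, `γ` non-decreasing and unbounded, `c ≥ 10`,
  operator norm), `‖∑_{n<x} μ(n) e(θn) U(f(n))‖ = o(x)` uniformly in `θ ∈ ℝ`. See the docstring
  of `MatrixMauduitRivat` for the comparison with the printed statement;
* for a base-`k` automaton with `d = k₀ = 1` and a zero-stable state `M`, with the GOOD LABELLING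
  `ρ = goodLabel M` (Lemma 2.14; all relabelled outputs `T̄(M, w)` lie in the group `G_M`,
  `Tρ_goodLabel_mem_loopGroup`): the good subspace `W = goodSubspace M` of `ℓ²(Perm (Fin n₀))` is
  `G_M`-invariant (`regRep_mem_goodSubspace`), `goodRep` is the restricted isometric
  representation of `G_M` on `W`, `goodSeq n = T̄(M,(n)_k) ∈ G_M`, and
  - `hasCarryProperty_goodSeq` (Lemma 4.10, from `MoebiusAutomaticCarryRelabel.lean`),
  - `hasFourierProperty_goodRep` (Thm. 4.5, from `MoebiusAutomaticFourierDecay.lean`),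
  - `exists_expSum_good_le` — **the uniform exponential-sum estimate on good vectors**:
    `MatrixMauduitRivat k` implies `‖∑_{n<x} μ(n) e(θn) R(T̄(M,(n)_k)) y‖ ≤ ε x ‖y‖` for all
    large `x`, all `θ`, and every `y ∈ W` (Müllner §4.3: "as `D(T(n+r))` fulfills (def:1) and
    (def:2) … we can apply Thm. 4.4").

## References
* C. Müllner, Duke Math. J. 166 (2017) = arXiv:1602.03042: Thm. 4.4 (p. 19), §4.3 (pp. 22–23),
  §3.1. [Mullner2017]
* C. Mauduit, J. Rivat, J. Eur. Math. Soc. 17 (2015) 2595–2642, Thm. 2 (the scalar theorem).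
  [MauduitRivat2015]
-/

noncomputable section

open Finset Complex
open scoped FourierTransform InnerProductSpace ArithmeticFunction.Moebius

namespace Literature.NumberTheory.LFunctions

/-! ## The left regular representation on `ℓ²(S)` -/

section RegRep

variable {S : Type} [Group S] [Fintype S]

/-- Reindexing `ℓ²(S)` by left multiplication: `(F ∘ (g⁻¹ ·))`. [folklore] -/
theorem piLpCongrLeft_mulLeft_apply (g : S) (F : EuclideanSpace ℂ S) (x : S) :
    LinearIsometryEquiv.piLpCongrLeft 2 ℂ ℂ (Equiv.mulLeft g) F x = F (g⁻¹ * x) := rfl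

/-- **The left regular representation** of a finite group `S` on `ℓ²(S)`:
`(R(g) F)(x) = F(g⁻¹ x)`. [folklore] -/
def regRep (S : Type) [Group S] [Fintype S] : S →* (EuclideanSpace ℂ S →ₗ[ℂ] EuclideanSpace ℂ S) where
  toFun g := ((LinearIsometryEquiv.piLpCongrLeft 2 ℂ ℂ (Equiv.mulLeft g)).toLinearEquiv :
    EuclideanSpace ℂ S →ₗ[ℂ] EuclideanSpace ℂ S)
  map_one' := LinearMap.ext fun F => PiLp.ext fun x => by
    show LinearIsometryEquiv.piLpCongrLeft 2 ℂ ℂ (Equiv.mulLeft (1 : S)) F x = F x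
    rw [piLpCongrLeft_mulLeft_apply, inv_one, one_mul]
  map_mul' g h := LinearMap.ext fun F => PiLp.ext fun x => by
    show LinearIsometryEquiv.piLpCongrLeft 2 ℂ ℂ (Equiv.mulLeft (g * h)) F x =
      LinearIsometryEquiv.piLpCongrLeft 2 ℂ ℂ (Equiv.mulLeft g)
        (LinearIsometryEquiv.piLpCongrLeft 2 ℂ ℂ (Equiv.mulLeft h) F) x
    rw [piLpCongrLeft_mulLeft_apply, piLpCongrLeft_mulLeft_apply, piLpCongrLeft_mulLeft_apply,
      mul_inv_rev, mul_assoc]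

/-- Pointwise formula for the regular representation. [folklore] -/
theorem regRep_apply_apply (g : S) (F : EuclideanSpace ℂ S) (x : S) :
    regRep S g F x = F (g⁻¹ * x) := rfl

/-- The regular representation is unitary. [folklore] -/
theorem norm_regRep (g : S) (F : EuclideanSpace ℂ S) : ‖regRep S g F‖ = ‖F‖ :=
  (LinearIsometryEquiv.piLpCongrLeft 2 ℂ ℂ (Equiv.mulLeft g)).norm_map F

/-- `R(g) δ_h = δ_{g h}`. [folklore] -/
theorem regRep_single [DecidableEq S] (g h : S) :
    regRep S g (EuclideanSpace.single h (1 : ℂ)) = EuclideanSpace.single (g * h) 1 := by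
  show LinearIsometryEquiv.piLpCongrLeft 2 ℂ ℂ (Equiv.mulLeft g) (PiLp.single 2 h (1 : ℂ)) = _
  rw [LinearIsometryEquiv.piLpCongrLeft_single]
  rfl

/-- **Indicators of group elements are matrix coefficients of the regular representation**:
`⟨δ_π, R(g) δ_1⟩ = [g = π]`. [cite: Mullner2017, §3.1 (reduction to representations)] -/
theorem inner_single_regRep_single [DecidableEq S] (π g : S) :
    ⟪EuclideanSpace.single π (1 : ℂ), regRep S g (EuclideanSpace.single 1 1)⟫_ℂ =
      if g = π then 1 else 0 := by
  rw [regRep_single, mul_one, EuclideanSpace.inner_single_left, map_one, one_mul, PiLp.single_apply]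
  simp [eq_comm]

end RegRep

/-! ## Müllner's Thm. 4.4 as an interface -/

/-- **Müllner 2017, Thm. 4.4 (the matrix-valued Mauduit–Rivat estimate for `μ`), operator form —
a property of the base `k`, NOT asserted here.** Printed statement (p. 19): "Let `γ : ℝ → ℝ` be
non-decreasing with `lim γ = +∞`, and `f : ℕ → U_d` satisfy Def. 4.1 (carry property) for some
`η ∈ (0,1]` and `f ∈ F_{γ,c}` for some `c ≥ 10` (Def. 4.2). Then for any `θ ∈ ℝ`,
`‖∑_{n ≤ x} μ(n) f(n) e(θn)‖ ≪ c₁(k) (log x)^{9/4 + max(ω(k),2)/4} x k^{−ηγ(2⌊log x/(80 log k)⌋)/20}`."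
Here, for the use in Prop. 3.2: `W` a finite-dimensional complex inner-product space in place of
`ℂ^d`, the unitary values given as `U(f(n))` for a `G`-valued `f` with the carry property in `G`
(`HasCarryProperty`, the tree's prefix-cancelling form of Def. 4.1 — the printed `f(x)^H f(y)`
becomes `f(x) f(y)⁻¹`, i.e. the printed theorem is applied to `n ↦ U(f(n))^H`, which has the same
Frobenius-norm Fourier sums at `−t` and the adjoint conclusion at `−θ`) and an isometric
representation `U` (carry violations of `U ∘ f` are among those of `f`), the Fourier property
with the OPERATOR norm (`≤` Frobenius, so the printed hypothesis holds with `γ − log_k √(dim W)`,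
again non-decreasing and unbounded), and only the qualitative consequence `= o(x)` uniformly in
`θ` of the printed bound (operator norm `≤` Frobenius norm). [cite: Mullner2017, Thm. 4.4] -/
def MatrixMauduitRivat (k : ℕ) : Prop :=
  ∀ (W : Type) [NormedAddCommGroup W] [InnerProductSpace ℂ W] [FiniteDimensional ℂ W]
    (G : Type) [Group G] (f : ℕ → G) (U : G →* (W →ₗ[ℂ] W)),
    (∀ (g : G) (w : W), ‖U g w‖ = ‖w‖) →
    ∀ (η C : ℝ) (γ : ℝ → ℝ) (c : ℝ), 0 < η → η ≤ 1 → HasCarryProperty k η C f →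
      Monotone γ → Filter.Tendsto γ Filter.atTop Filter.atTop → 10 ≤ c →
      MauduitRivat.HasFourierProperty k γ c (fun n => LinearMap.toContinuousLinearMap (U (f n))) →
      ∀ ε : ℝ, 0 < ε → ∃ x₀ : ℕ, ∀ x : ℕ, x₀ ≤ x → ∀ θ : ℝ,
        ‖∑ n ∈ Finset.range x, ((μ n : ℂ) * Complex.exp (2 * Real.pi * Complex.I * (θ * n))) •
          LinearMap.toContinuousLinearMap (U (f n))‖ ≤ ε * x

/-! ## Carry violations in a subgroup -/

/-- The carry violations of a subgroup-valued sequence are those of the ambient-valued one.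
[folklore] -/
theorem carryViolations_subgroup {G : Type*} [Group G] (H : Subgroup G) (k : ℕ) (f : ℕ → H)
    (lam α ρ : ℕ) : carryViolations k f lam α ρ = carryViolations k (fun n => (f n : G)) lam α ρ := by
  ext ℓ
  simp only [mem_carryViolations, ne_eq, Subtype.ext_iff, Subgroup.coe_mul, Subgroup.coe_inv]

/-- The carry property of a subgroup-valued sequence is that of the ambient-valued one. [folklore] -/
theorem hasCarryProperty_subgroup_iff {G : Type*} [Group G] (H : Subgroup G) (k : ℕ) (η C : ℝ)
    (f : ℕ → H) : HasCarryProperty k η C f ↔ HasCarryProperty k η C (fun n => (f n : G)) := by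
  simp only [HasCarryProperty, carryViolations_subgroup]

/-! ## The good labelling: all relabelled outputs lie in the group -/

namespace MinImage

variable {σ : Type*} [Fintype σ] [DecidableEq σ] {δ : σ → ℕ → σ} {k : ℕ}

/-- With the good labelling rooted at `M` and `d = 1`, EVERY relabelled output `T̄(M, w)` lies in
`G_M` (Lemma 2.14 with Thm. 2.7 (1); `ρ_M = 1`). [cite: Mullner2017, Lemma 2.14, Thm. 2.7] -/
theorem Tρ_goodLabel_mem_loopGroup (hk : 2 ≤ k) (htriv : ∀ q d, k ≤ d → δ q d = q)
    (hd : transducerPeriod k δ = 1) (M : MinImage δ) {w : List ℕ} (hwd : ∀ d ∈ w, d < k) :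
    M.Tρ (goodLabel (by omega : 0 < k) htriv M) w ∈ M.loopGroup (by omega : 0 < k) htriv := by
  have hk0 : 0 < k := by omega
  have h := Tρ_goodLabel_mem hk0 htriv M M hwd (by rw [hd]; exact one_dvd _)
  rw [mem_loopGroupρ, mem_pathOutputsρ_iff, goodLabel_self, one_trans_eq] at h
  rw [mem_loopGroup]
  have e : (M.Tρ (goodLabel hk0 htriv M) w).trans (1 : Equiv.Perm (Fin (minRank δ))).symm =
      M.Tρ (goodLabel hk0 htriv M) w := by
    rw [← Equiv.Perm.inv_def, inv_one]; exact trans_one_eq _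
  rwa [e] at h

/-- With the good labelling, loops at the root are not conjugated: `conjρ M g = g`. [folklore] -/
theorem conjρ_goodLabel_self (hk0 : 0 < k) (htriv : ∀ q d, k ≤ d → δ q d = q) (M : MinImage δ)
    (g : Equiv.Perm (Fin (minRank δ))) : conjρ (goodLabel hk0 htriv M) M g = g := by
  rw [conjρ_eq_mul, goodLabel_self, one_mul, inv_one, mul_one]

/-- The digits of `n`, most significant first, are letters `< k`. [folklore] -/
theorem digits_reverse_lt (hk : 2 ≤ k) (n : ℕ) : ∀ d ∈ (Nat.digits k n).reverse, d < k :=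
  fun _ hd => Nat.digits_lt_base hk (List.mem_reverse.1 hd)

/-! ## The good subspace is `G_M`-invariant; the restricted representation -/

/-- **`G_M` preserves the good subspace at `M`** (good labelling): realise `g` by a loop `w`,
then `R(T̄(M,w)) = R(g)` maps `goodSubspace M` into `goodSubspace δ(M,w) = goodSubspace M`.
[cite: Mullner2017, Thm. 4.5 (structure)] -/
theorem regRep_mem_goodSubspace (hk : 2 ≤ k) (htriv : ∀ q d, k ≤ d → δ q d = q)
    [NeZero (transducerDPrime hk δ htriv)] (hd : transducerPeriod k δ = 1)
    (hk0 : transducerK0 hk δ htriv = 1) (M : MinImage δ) {g : Equiv.Perm (Fin (minRank δ))}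
    (hg : g ∈ M.loopGroup (by omega : 0 < k) htriv) {y : EuclideanSpace ℂ (Equiv.Perm (Fin (minRank δ)))}
    (hy : y ∈ M.goodSubspace hk htriv (regRep _) (goodLabel (by omega : 0 < k) htriv M)) :
    regRep _ g y ∈ M.goodSubspace hk htriv (regRep _) (goodLabel (by omega : 0 < k) htriv M) := by
  have hk0' : 0 < k := by omega
  obtain ⟨w, hwd, -, hwn, hwT⟩ := (s0_spec hk htriv (δ := δ)).2.1 M _ le_rfl g hg
  have h := M.A_Tρ_mem_goodSubspace hk htriv hd hk0 (regRep _) norm_regRep (goodLabel hk0' htriv M) hwd hy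
  rwa [hwn, Tρ_eq_conjρ _ M hwn, hwT, conjρ_goodLabel_self] at h

/-- **The restricted representation** of `G_M` on the good subspace (good labelling).
[cite: Mullner2017, §4.3] -/
def goodRep (hk : 2 ≤ k) (htriv : ∀ q d, k ≤ d → δ q d = q) [NeZero (transducerDPrime hk δ htriv)]
    (hd : transducerPeriod k δ = 1) (hk0 : transducerK0 hk δ htriv = 1) (M : MinImage δ) :
    ↥(M.loopGroup (by omega : 0 < k) htriv) →*
      (↥(M.goodSubspace hk htriv (regRep _) (goodLabel (by omega : 0 < k) htriv M)) →ₗ[ℂ]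
        ↥(M.goodSubspace hk htriv (regRep _) (goodLabel (by omega : 0 < k) htriv M))) where
  toFun g := (regRep _ (g : Equiv.Perm (Fin (minRank δ)))).restrict
    fun _ hy => M.regRep_mem_goodSubspace hk htriv hd hk0 g.2 hy
  map_one' := LinearMap.ext fun y => Subtype.ext (by
    simp only [LinearMap.restrict_apply, OneMemClass.coe_one, map_one, Module.End.one_apply])
  map_mul' g h := LinearMap.ext fun y => Subtype.ext (by
    simp only [LinearMap.restrict_apply, Subgroup.coe_mul, map_mul, Module.End.mul_apply])

/-- The restricted representation acts as `R` on vectors. [folklore] -/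
theorem coe_goodRep_apply (hk : 2 ≤ k) (htriv : ∀ q d, k ≤ d → δ q d = q)
    [NeZero (transducerDPrime hk δ htriv)] (hd : transducerPeriod k δ = 1)
    (hk0 : transducerK0 hk δ htriv = 1) (M : MinImage δ) (g : ↥(M.loopGroup (by omega : 0 < k) htriv))
    (y : ↥(M.goodSubspace hk htriv (regRep _) (goodLabel (by omega : 0 < k) htriv M))) :
    ((M.goodRep hk htriv hd hk0 g y : ↥(M.goodSubspace hk htriv (regRep _) (goodLabel (by omega : 0 < k) htriv M))) :
      EuclideanSpace ℂ (Equiv.Perm (Fin (minRank δ)))) = regRep _ (g : Equiv.Perm (Fin (minRank δ))) y :=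
  rfl

/-- The restricted representation is isometric. [folklore] -/
theorem norm_goodRep (hk : 2 ≤ k) (htriv : ∀ q d, k ≤ d → δ q d = q)
    [NeZero (transducerDPrime hk δ htriv)] (hd : transducerPeriod k δ = 1)
    (hk0 : transducerK0 hk δ htriv = 1) (M : MinImage δ) (g : ↥(M.loopGroup (by omega : 0 < k) htriv))
    (y : ↥(M.goodSubspace hk htriv (regRep _) (goodLabel (by omega : 0 < k) htriv M))) :
    ‖M.goodRep hk htriv hd hk0 g y‖ = ‖y‖ := by
  rw [Submodule.coe_norm, Submodule.coe_norm, coe_goodRep_apply, norm_regRep]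

/-- **The output sequence in the group**: `n ↦ T̄(M, (n)_k) ∈ G_M` (good labelling, `d = 1`).
[cite: Mullner2017, §4 (f(n) = D(T(q₀,(n)_k)))] -/
def goodSeq (hk : 2 ≤ k) (htriv : ∀ q d, k ≤ d → δ q d = q) (hd : transducerPeriod k δ = 1)
    (M : MinImage δ) (n : ℕ) : ↥(M.loopGroup (by omega : 0 < k) htriv) :=
  ⟨M.Tρ (goodLabel (by omega : 0 < k) htriv M) ((Nat.digits k n).reverse),
    M.Tρ_goodLabel_mem_loopGroup hk htriv hd (digits_reverse_lt hk n)⟩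

/-- Unfolding `goodSeq`. [folklore] -/
theorem coe_goodSeq (hk : 2 ≤ k) (htriv : ∀ q d, k ≤ d → δ q d = q) (hd : transducerPeriod k δ = 1)
    (M : MinImage δ) (n : ℕ) :
    (M.goodSeq hk htriv hd n : Equiv.Perm (Fin (minRank δ))) =
      M.Tρ (goodLabel (by omega : 0 < k) htriv M) ((Nat.digits k n).reverse) := rfl

/-- **Lemma 4.10 for `goodSeq`**: the carry property (one `η ∈ (0,1]` and `C` for all zero-stable
`M`). [cite: Mullner2017, Lemma 4.10] -/
theorem hasCarryProperty_goodSeq (hk : 2 ≤ k) (htriv : ∀ q d, k ≤ d → δ q d = q)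
    (hd : transducerPeriod k δ = 1) :
    ∃ η : ℝ, 0 < η ∧ η ≤ 1 ∧ ∃ C : ℝ, ∀ (M : MinImage δ), M.next [0] = M → M.T [0] = 1 →
      HasCarryProperty k η C (M.goodSeq hk htriv hd) := by
  obtain ⟨η, hη0, hη1, C, hC⟩ := hasCarryProperty_Tρ (δ := δ) hk htriv
  refine ⟨η, hη0, hη1, C, fun M h0 h1 => ?_⟩
  rw [hasCarryProperty_subgroup_iff]
  exact hC _ M h0 h1

/-- **Thm. 4.5 for `goodRep ∘ goodSeq`** (zero-stable `M`): with constants `C, θ` as provided by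
`exists_fourier_decay_digits` (for the good labelling rooted at `M`), the operator sequence `n ↦ U(T̄(M,(n)_k))|_W` has the Fourier
property with `γ(λ) = θλ − log_k C` and any `c`. [cite: Mullner2017, Thm. 4.5 with Def. 4.2] -/
theorem hasFourierProperty_goodRep (hk : 2 ≤ k) (htriv : ∀ q d, k ≤ d → δ q d = q)
    [NeZero (transducerDPrime hk δ htriv)] (hd : transducerPeriod k δ = 1)
    (hk0 : transducerK0 hk δ htriv = 1) {C θ : ℝ} (hC : 0 < C) {M : MinImage δ}
    (h : ∀ y ∈ M.goodSubspace hk htriv (regRep _) (goodLabel (by omega : 0 < k) htriv M),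
        ∀ (α lam : ℕ) (t : ℝ),
        ‖∑ u ∈ range (k ^ lam), ((𝐞 (-((u : ℝ) * t)) : Circle) : ℂ) •
            regRep _ (M.Tρ (goodLabel (by omega : 0 < k) htriv M) ((Nat.digits k (u * k ^ α)).reverse)) y‖ ≤
          C * (k : ℝ) ^ lam * (k : ℝ) ^ (-(θ * lam)) * ‖y‖) (c : ℝ) :
    MauduitRivat.HasFourierProperty k (fun lam => θ * lam - Real.logb k C) c
      (fun n => LinearMap.toContinuousLinearMap (M.goodRep hk htriv hd hk0 (M.goodSeq hk htriv hd n))) := by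
  intro α lam _ t
  have hk1 : (1 : ℝ) < k := by exact_mod_cast (hk : 1 < k)
  have hkpos : (0 : ℝ) < k := by positivity
  have hklam : (0 : ℝ) < (k : ℝ) ^ lam := by positivity
  have hk0' : 0 < k := by omega
  -- the target bound `k^{-γ λ} = C k^{-θ λ}`
  have e : (k : ℝ) ^ (-(θ * lam - Real.logb k C)) = (k : ℝ) ^ (-(θ * lam)) * C := by
    rw [show -(θ * lam - Real.logb k C) = -(θ * lam) + Real.logb k C by ring,
      Real.rpow_add hkpos, Real.rpow_logb hkpos hk1.ne' hC]
  set T : ↥(M.goodSubspace hk htriv (regRep _) (goodLabel hk0' htriv M)) →L[ℂ]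
      ↥(M.goodSubspace hk htriv (regRep _) (goodLabel hk0' htriv M)) :=
    ∑ u ∈ range (k ^ lam), ((𝐞 (-((u : ℝ) * t)) : Circle) : ℂ) •
      LinearMap.toContinuousLinearMap (M.goodRep hk htriv hd hk0 (M.goodSeq hk htriv hd (u * k ^ α)))
    with hT
  -- evaluate at `w` and pass to the ambient space
  have hTw : ∀ w : ↥(M.goodSubspace hk htriv (regRep _) (goodLabel hk0' htriv M)),
      ((T w : ↥(M.goodSubspace hk htriv (regRep _) (goodLabel hk0' htriv M))) :
        EuclideanSpace ℂ (Equiv.Perm (Fin (minRank δ)))) =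
        ∑ u ∈ range (k ^ lam), ((𝐞 (-((u : ℝ) * t)) : Circle) : ℂ) •
          regRep _ (M.Tρ (goodLabel hk0' htriv M) ((Nat.digits k (u * k ^ α)).reverse))
            (w : EuclideanSpace ℂ (Equiv.Perm (Fin (minRank δ)))) := by
    intro w
    rw [hT, _root_.sum_apply, Submodule.coe_sum]
    refine Finset.sum_congr rfl fun u _ => ?_
    rw [FunLike.coe_smul, Pi.smul_apply, Submodule.coe_smul, LinearMap.coe_toContinuousLinearMap',
      coe_goodRep_apply, coe_goodSeq]
  have hbound : ∀ w : ↥(M.goodSubspace hk htriv (regRep _) (goodLabel hk0' htriv M)),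
      ‖T w‖ ≤ C * (k : ℝ) ^ lam * (k : ℝ) ^ (-(θ * lam)) * ‖w‖ := fun w => by
    rw [Submodule.coe_norm, Submodule.coe_norm w, hTw]
    exact h _ w.2 α lam t
  have hop : ‖T‖ ≤ C * (k : ℝ) ^ lam * (k : ℝ) ^ (-(θ * lam)) :=
    ContinuousLinearMap.opNorm_le_bound _ (by positivity) hbound
  show _ ≤ (k : ℝ) ^ (-(θ * lam - Real.logb k C))
  rw [e, norm_smul, norm_inv, Real.norm_of_nonneg hklam.le]
  calc ((k : ℝ) ^ lam)⁻¹ * ‖T‖ ≤ ((k : ℝ) ^ lam)⁻¹ * (C * (k : ℝ) ^ lam * (k : ℝ) ^ (-(θ * lam))) := by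
        gcongr
    _ = (k : ℝ) ^ (-(θ * ↑lam)) * C := by field_simp

/-- **Müllner §4.3 on good vectors: Thm. 4.4 applied to `R(T̄(M,(n)_k))|_W`.** If
`MatrixMauduitRivat k` holds then for every zero-stable state `M` (`d = k₀ = 1`, good labelling),
every `y` in the good subspace at `M` and every `ε > 0`, for all large `x` and ALL real `θ`,
`‖∑_{n<x} μ(n) e(θn) R(T̄(M,(n)_k)) y‖ ≤ ε x ‖y‖`. [cite: Mullner2017, §4.3 (proof of Prop. 3.2)] -/
theorem exists_expSum_good_le (H : MatrixMauduitRivat k) (hk : 2 ≤ k)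
    (htriv : ∀ q d, k ≤ d → δ q d = q) [NeZero (transducerDPrime hk δ htriv)]
    (hd : transducerPeriod k δ = 1) (hk0 : transducerK0 hk δ htriv = 1) (M : MinImage δ)
    (h0 : M.next [0] = M) (h1 : M.T [0] = 1) {ε : ℝ} (hε : 0 < ε) :
    ∃ x₀ : ℕ, ∀ x : ℕ, x₀ ≤ x → ∀ θ : ℝ,
      ∀ y ∈ M.goodSubspace hk htriv (regRep _) (goodLabel (by omega : 0 < k) htriv M),
        ‖∑ n ∈ range x, ((μ n : ℂ) * Complex.exp (2 * Real.pi * Complex.I * (θ * n))) •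
            regRep _ (M.Tρ (goodLabel (by omega : 0 < k) htriv M) ((Nat.digits k n).reverse)) y‖ ≤
          ε * x * ‖y‖ := by
  have hk0' : 0 < k := by omega
  -- carry property
  obtain ⟨η, hη0, hη1, C₁, hC₁⟩ := hasCarryProperty_goodSeq (δ := δ) hk htriv hd
  -- Fourier property
  obtain ⟨C, θ, hC, hθ, h45⟩ :=
    exists_fourier_decay_digits hk htriv hd hk0 (regRep _) norm_regRep (goodLabel hk0' htriv M)
  have hF := hasFourierProperty_goodRep hk htriv hd hk0 hC (h45 M h0 h1) 10
  -- the function `γ`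
  have hmono : Monotone (fun lam : ℝ => θ * lam - Real.logb k C) := fun a b hab => by
    simp only; nlinarith
  have htend : Filter.Tendsto (fun lam : ℝ => θ * lam - Real.logb k C) Filter.atTop Filter.atTop := by
    simp only [sub_eq_add_neg]
    exact Filter.tendsto_atTop_add_const_right _ _ (Filter.Tendsto.const_mul_atTop hθ Filter.tendsto_id)
  obtain ⟨x₀, hx₀⟩ := H _ _ (M.goodSeq hk htriv hd) (M.goodRep hk htriv hd hk0)
    (M.norm_goodRep hk htriv hd hk0) η C₁ _ 10 hη0 hη1 (hC₁ M h0 h1) hmono htend le_rfl hF ε hε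
  refine ⟨x₀, fun x hx θ' y hy => ?_⟩
  have hop := hx₀ x hx θ'
  set T : ↥(M.goodSubspace hk htriv (regRep _) (goodLabel hk0' htriv M)) →L[ℂ]
      ↥(M.goodSubspace hk htriv (regRep _) (goodLabel hk0' htriv M)) :=
    ∑ n ∈ range x, ((μ n : ℂ) * Complex.exp (2 * Real.pi * Complex.I * (θ' * n))) •
      LinearMap.toContinuousLinearMap (M.goodRep hk htriv hd hk0 (M.goodSeq hk htriv hd n)) with hT
  have hTy : ((T ⟨y, hy⟩ : ↥(M.goodSubspace hk htriv (regRep _) (goodLabel hk0' htriv M))) :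
      EuclideanSpace ℂ (Equiv.Perm (Fin (minRank δ)))) =
      ∑ n ∈ range x, ((μ n : ℂ) * Complex.exp (2 * Real.pi * Complex.I * (θ' * n))) •
        regRep _ (M.Tρ (goodLabel hk0' htriv M) ((Nat.digits k n).reverse)) y := by
    rw [hT, _root_.sum_apply, Submodule.coe_sum]
    refine Finset.sum_congr rfl fun n _ => ?_
    rw [FunLike.coe_smul, Pi.smul_apply, Submodule.coe_smul, LinearMap.coe_toContinuousLinearMap',
      coe_goodRep_apply, coe_goodSeq]
  have hle := (T.le_opNorm ⟨y, hy⟩).trans (mul_le_mul_of_nonneg_right hop (norm_nonneg _))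
  rw [Submodule.coe_norm, Submodule.coe_norm, hTy] at hle
  exact hle

end MinImage

end Literature.NumberTheory.LFunctions
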